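/-
COR-CM (cell pub-hodgecm2, stage 2 of the Hodge ladder) — count-neutral KERNEL COMBINATORICS «the sheared dihedral family», part V: the slice model
for odd n — gen 44ʼs quadruple labels with the motion of `t` (`t² = c`) replaced by the motion of the involution `s` (seat prover-pub-hodgecm2-b23-g52-0,
binder prover b23, gen 52; claim «SYLOW TRANSFER XII + THE SHEARED DIHEDRAL FAMILY», HOME/INBOX.md l.23708).  Bookkeeping definitions with bodies
(`twS`, `twSEquiv`, `translS`, `translSHom`) + theorems, on top of gen 44ʼs `Census/QuarticInversionModel.lean` / `…Hodge.lean` (`Ty₄`, `twH₄`, `twY`,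
`translH₄`, `translY`, `Marg₀`, `Marg₁`, `hodge₄`, `pairVec₄`, `halfConj₁`) used BY NAME; no `decide` table, no certificate, no named fact, no geometry, no
`sorry`.  `Interfaces.lean` (C1), every E term, B01, `Transposition/*`, `PortJoin/*`, `D2Bridge/*` untouched.
HONEST FRAMING: `HC_CM` is NOT proved, here or anywhere in the tree; nothing here is a period, a count of record or a headline.
-/
import Summits.HodgeConjecture.CorCM.Census.QuarticInversionHodge

/-!
# The sheared dihedral family, V: the slice model of `X_n = G_n` (`n` odd) — gen 44ʼs `Ty₄` with the involutive motion `twS`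

For `n` odd the sheared dihedral group `G_n = X_n = ⟨g, s, x⟩` (part I) is a QUARTIC-INVERSION-TYPE datum in the sense of gen 44
(`Census/QuarticInversionDictionary.lean`): `H₀ = ⟨g⟩ = ⟨c⟩ × ⟨g²⟩ ≅ ℤ/2 × B` (`B = ℤ/n`, `ι(ε, a) = c^ε g^{2a}`), `y := x` INVERTS `H₀` with `y² = 1`
(square class `ζ = 0`), `t := s` CENTRALISES `H₀` with `y t = c t y` (`x s = c s x`) — but **`t² = s² = 1` instead of `t² = c`**.  The abstract CM types
of `(X_n, c)` are therefore gen 44ʼs quadruple labels `Θ = ((ψ₀, ψ₁), (ψ₂, ψ₃)) ∈ Ty₄ B` (cosets `H₀, xH₀, sH₀, sxH₀`) with the motions `twH₄` (of `H₀`) and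
`twY 0` (of `x`) VERBATIM, and — in place of `twT ((ψ₀,ψ₁),(ψ₂,ψ₃)) = ((ψ₂, ψ₃+1), (ψ₀+1, ψ₁))` — the INVOLUTION
  **`twS ((ψ₀,ψ₁),(ψ₂,ψ₃)) = ((ψ₂, ψ₃ + 1), (ψ₀, ψ₁ + 1))`**
(base change along `s`: `res_{H₀}(Ψs⁻¹)(h) = [hs ∈ Ψ] = [sh ∈ Ψ] = ψ₂(h)`; `res_{sH₀}(Ψs⁻¹)(h) = [shs ∈ Ψ] = ψ₀(h)` since `s² = 1`;
`res_{xH₀}(Ψs⁻¹)(h) = [xhs ∈ Ψ] = [s·x·ch ∈ Ψ] = ψ₃(h) + 1` and `res_{sxH₀}(Ψs⁻¹)(h) = [sxhs ∈ Ψ] = [x·ch ∈ Ψ] = ψ₁(h) + 1` since `x s = c s x`).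
* §1 `twS`, the relations **`twS_twS : twS ∘ twS = id`** (`s² = 1`), **`twS_twH₄`** (`s` centralises `H₀`), **`twY_twS : twY ζ ∘ twS = twH₄ c ∘ twS ∘ twY ζ`**
  (`s⁻¹ y s = c y`), the permutation `twSEquiv`;
* §2 the translate `translS` of exponent vectors, `translS_single`, **`Marg₀_translS = halfConj₁ ∘ Marg₁`**, **`Marg₁_translS = halfConj₁ ∘ Marg₀`**, hence
  **`translS_mem`** (`hodge₄` is `s`-stable) and **`translS_pairVec₄`** (pairs go to pairs).
So `ℤ[X_n]` acts on `ℤ[Ty₄ B]` through `translH₄`, `translY 0`, `translS`, preserving gen 44ʼs Hodge lattice `hodge₄` and pairs `pairs₄`; the X_n column is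
gen 44/45ʼs chain with this one motion changed (numerics, `HOME/pub-hodgecm2-b23/SHEARED-DIHEDRAL.md` §3b: the label model has `β = 194` orbits at `B = ℤ/3`
(= `β(X₃)`, part III) against `204` for `twT` (`D(ℤ/12)`); exactly `12` residual blocks of potential `≤ 1` for `B = ℤ/3, ℤ/5`, as for gen 44ʼs `ζ = 0`).
All [folklore] (Pohlmannʼs dictionary [Pohlmann1968, Thm 1] along an iterated index-two descent).

## References
* [Pohlmann1968] H. Pohlmann, Algebraic cycles on abelian varieties of complex multiplication type, Ann. of Math. 88 (1968), Thm 1.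
* [Milne1999] J. S. Milne, Lefschetz motives and the Tate conjecture, Compositio Math. 117 (1999), Prop. 2.1, p. 54.
-/

namespace Summit.HodgeConjecture.CorCM.Census.ShearedDihedral

open Finset
open Summit.HodgeConjecture.CorCM.Census.OddSliceFacesModel
open Summit.HodgeConjecture.CorCM.Census.DicyclicTwist (Ty₂ rev rev_rev rev_add_one rev_add twH twH_twH twH_zero twH_one_zero
  marg₀ marg₁ marg₀_apply marg₁_apply hodge₂ mem_hodge₂_iff conj pairVec₂)
open Summit.HodgeConjecture.CorCM.Census.QuarticInversion

/-! ## §1 The motion of `s` on quadruple labels -/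

section Labels

variable (A : Type) [AddCommGroup A] [DecidableEq A]

/-- **The motion of the involution `s`** (`s` centralises `H₀`, `s² = 1`, `s⁻¹ y s = c y`):
`((ψ₀,ψ₁),(ψ₂,ψ₃)) ↦ ((ψ₂, ψ₃ + 1), (ψ₀, ψ₁ + 1))`. [folklore] -/
def twS (Θ : Ty₄ A) : Ty₄ A := ((Θ.2.1, Θ.2.2 + 1), (Θ.1.1, Θ.1.2 + 1))

omit [AddCommGroup A] [DecidableEq A] in
/-- **`s² = 1`: `twS ∘ twS = id`.** [folklore] -/
@[simp] theorem twS_twS (Θ : Ty₄ A) : twS A (twS A Θ) = Θ := by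
  obtain ⟨⟨ψ₀, ψ₁⟩, ⟨ψ₂, ψ₃⟩⟩ := Θ
  simp only [twS, add_one_add_one]

omit [DecidableEq A] in
/-- **`s` centralises `H₀`**: `twS ∘ twH₄ g = twH₄ g ∘ twS`. [folklore] -/
theorem twS_twH₄ (g : ZMod 2 × A) (Θ : Ty₄ A) : twS A (twH₄ A g Θ) = twH₄ A g (twS A Θ) := by
  obtain ⟨⟨ψ₀, ψ₁⟩, ⟨ψ₂, ψ₃⟩⟩ := Θ
  simp only [twS, twH₄, twH, tw_add_one]

omit [DecidableEq A] in
/-- **`s⁻¹ y s = c y`**: `twY ζ ∘ twS = twH₄ (1,0) ∘ twS ∘ twY ζ` (base changes compose contravariantly). [folklore] -/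
theorem twY_twS (ζ : ZMod 2) (Θ : Ty₄ A) : twY A ζ (twS A Θ) = twH₄ A (1, 0) (twS A (twY A ζ Θ)) := by
  obtain ⟨⟨ψ₀, ψ₁⟩, ⟨ψ₂, ψ₃⟩⟩ := Θ
  rw [twH₄_one_zero]
  refine Prod.ext (Prod.ext ?_ ?_) (Prod.ext ?_ ?_)
  · show rev A (ψ₃ + 1) = rev A ψ₃ + 1
    exact rev_add_one A ψ₃
  · show rev A ψ₂ + cst A ζ = rev A ψ₂ + cst A ζ + 1 + 1
    rw [add_one_add_one]
  · show rev A (ψ₁ + 1) = rev A ψ₁ + 1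
    exact rev_add_one A ψ₁
  · show rev A ψ₀ + cst A ζ = rev A ψ₀ + cst A ζ + 1 + 1
    rw [add_one_add_one]

omit [DecidableEq A] in
/-- **`(s x)² = c` on labels**: `twS ∘ twY 0 ∘ twS ∘ twY 0 = twH₄ (1, 0)` (the dicyclic core `⟨g, sx⟩`). [folklore] -/
theorem twS_twY_twS_twY (Θ : Ty₄ A) : twS A (twY A 0 (twS A (twY A 0 Θ))) = twH₄ A (1, 0) Θ := by
  rw [twY_twS, twS_twH₄, twS_twS, twY_twY, twH₄_twH₄, Prod.mk_add_mk, zero_add, add_zero]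

/-- The motion of `s` as a permutation of the labels (an involution). [folklore] -/
def twSEquiv : Ty₄ A ≃ Ty₄ A where
  toFun := twS A
  invFun := twS A
  left_inv := twS_twS A
  right_inv := twS_twS A

end Labels

/-! ## §2 Translates of exponent vectors by `s`; the Hodge lattice and the pairs are `s`-stable -/

section Vectors

variable (A : Type) [AddCommGroup A] [Fintype A] [DecidableEq A]

/-- Translate of an exponent vector by `s`: `(s·v)(Θ) = v(s⁻¹ Θ) = v(twS Θ)`. [folklore] -/
def translS (v : Ty₄ A → ℤ) : Ty₄ A → ℤ := fun Θ => v (twS A Θ)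

/-- Translation by `s` as a `ℤ`-linear map. [folklore] -/
def translSHom : (Ty₄ A → ℤ) →ₗ[ℤ] (Ty₄ A → ℤ) where
  toFun := translS A
  map_add' _ _ := rfl
  map_smul' _ _ := rfl

omit [Fintype A] [AddCommGroup A] [DecidableEq A] in
/-- `translSHom v = translS v`. [folklore] -/
@[simp] theorem translSHom_apply (v : Ty₄ A → ℤ) : translSHom A v = translS A v := rfl

omit [Fintype A] [AddCommGroup A] [DecidableEq A] in
/-- `s` is an involution on exponent vectors. [folklore] -/
@[simp] theorem translS_translS (v : Ty₄ A → ℤ) : translS A (translS A v) = v := by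
  funext Θ; simp only [translS, twS_twS]

omit [AddCommGroup A] [DecidableEq A] in
/-- Translate of a unit vector by `s`. [folklore] -/
theorem translS_single (Θ : Ty₄ A) (n : ℤ) : translS A (Pi.single Θ n) = Pi.single (twS A Θ) n := by
  funext Φ
  have hiff : twS A Φ = Θ ↔ Φ = twS A Θ := by
    constructor
    · intro h; rw [← h, twS_twS]
    · intro h; rw [h, twS_twS]
  simp only [translS, Pi.single_apply, hiff]

omit [AddCommGroup A] in
/-- **`Marg₀` of the `s`-translate is the `1`-half-conjugated `Marg₁`.** [folklore] -/
theorem Marg₀_translS (v : Ty₄ A → ℤ) : Marg₀ A (translS A v) = halfConj₁ A (Marg₁ A v) := by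
  funext Ψ
  rw [Marg₀_apply]
  show ∑ Ψ' : Ty₂ A, v (twS A (Ψ, Ψ')) = ∑ Φ : Ty₂ A, v (Φ, (Ψ.1, Ψ.2 + 1))
  exact Fintype.sum_equiv (halfConj₁Equiv A) _ _ fun Ψ' => rfl

omit [AddCommGroup A] in
/-- **`Marg₁` of the `s`-translate is the `1`-half-conjugated `Marg₀`** (for `t` it was the `0`-half-conjugate: the one difference). [folklore] -/
theorem Marg₁_translS (v : Ty₄ A → ℤ) : Marg₁ A (translS A v) = halfConj₁ A (Marg₀ A v) := by
  funext Ψ'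
  rw [Marg₁_apply]
  show ∑ Ψ : Ty₂ A, v (twS A (Ψ, Ψ')) = ∑ Φ : Ty₂ A, v ((Ψ'.1, Ψ'.2 + 1), Φ)
  exact Fintype.sum_equiv (halfConj₁Equiv A) _ _ fun Ψ => rfl

/-- **`H₄` is stable under the motion of `s`.** [folklore] -/
theorem translS_mem {v : Ty₄ A → ℤ} (hv : v ∈ hodge₄ A) : translS A v ∈ hodge₄ A := by
  rw [mem_hodge₄_iff] at hv ⊢
  rw [Marg₀_translS, Marg₁_translS]
  exact ⟨halfConj₁_mem A hv.2, halfConj₁_mem A hv.1⟩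

omit [DecidableEq A] in
/-- **An `s`-translate of a pair is a pair.** [folklore] -/
theorem translS_pairVec₄ (Θ : Ty₄ A) : translS A (pairVec₄ A Θ) = pairVec₄ A (twS A Θ) := by
  have h2 : twS A (conj₄ A Θ) = conj₄ A (twS A Θ) := by
    rw [conj₄_eq_twH₄, conj₄_eq_twH₄, twS_twH₄]
  show translSHom A (Pi.single Θ 1 + Pi.single (conj₄ A Θ) 1) =
    Pi.single (twS A Θ) 1 + Pi.single (conj₄ A (twS A Θ)) 1
  rw [map_add, translSHom_apply, translSHom_apply, translS_single, translS_single, h2]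

omit [DecidableEq A] in
/-- **`P₄` is `s`-stable.** [folklore] -/
theorem translS_mem_pairs₄ {v : Ty₄ A → ℤ} (hv : v ∈ pairs₄ A) : translS A v ∈ pairs₄ A := by
  change translSHom A v ∈ pairs₄ A
  refine Submodule.span_induction (p := fun v _ => translSHom A v ∈ pairs₄ A) ?_ ?_ ?_ ?_ hv
  · rintro _ ⟨Θ, rfl⟩
    rw [translSHom_apply, translS_pairVec₄]
    exact Submodule.subset_span ⟨twS A Θ, rfl⟩
  · rw [map_zero]; exact zero_mem _
  · intro u w _ _ hu hw; rw [map_add]; exact add_mem hu hw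
  · intro a u _ hu; rw [map_smul]; exact Submodule.smul_mem _ a hu

end Vectors

end Summit.HodgeConjecture.CorCM.Census.ShearedDihedral
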